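import Summits.Ventures.CertifiedManyBodySolver.Theorems.M3x2EdgeSplitSymReplaySoundB
import HarnessLib

/-!
# SymReplay S4 layer C — supports of `lhsPoly`/`rhsPoly`, the residual equation, the enlarged frame `bigFrame` (T8; hub-lb-sym-eng-3)
No summit or crux statement is proved here; no certificate beyond toys is replayed; nothing here predicts superconductivity.
-/

noncomputable section

namespace Summit.Ventures.CertifiedManyBodySolver.Theorems.SymReplay

open Matrix Finset
open Literature.MathematicalPhysics.QuantumLattice
open Literature.MathematicalPhysics.QuantumLattice.HubbardWave0
open Literature.MathematicalPhysics.QuantumLattice.ThermodynamicLimit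
open Literature.Probability.LatticeModels
open Literature.MathematicalPhysics.QuantumManyBody.StateRelaxation
open Summit.Ventures.CertifiedManyBodySolver.Theorems.WardSlot
open scoped ComplexOrder BigOperators

/-! ##### (h) Supports: every word the checker manipulates lives in the frame -/

/-- Helper `PSupp.append` (S4 chain). -/
theorem PSupp.append {p r : QPoly} {Λ : Finset (Site 2)} (hp : PSupp p Λ) (hr : PSupp r Λ) : PSupp (p ++ r) Λ :=
  fun t ht => (List.mem_append.1 ht).elim (hp t) (hr t)

/-- Helper `PSupp.pscale` (S4 chain). -/
theorem PSupp.pscale {p : QPoly} {Λ : Finset (Site 2)} (q : ℚ) (hp : PSupp p Λ) : PSupp (pscale q p) Λ := by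
  intro t ht
  simp only [SymReplay.pscale, List.mem_map] at ht
  obtain ⟨s, hs, rfl⟩ := ht
  exact hp s hs

/-- Helper `PSupp.psub` (S4 chain). -/
theorem PSupp.psub {p r : QPoly} {Λ : Finset (Site 2)} (hp : PSupp p Λ) (hr : PSupp r Λ) : PSupp (psub p r) Λ :=
  hp.append (hr.pscale _)

/-- Helper `PSupp.pmul` (S4 chain). -/
theorem PSupp.pmul {p r : QPoly} {Λ : Finset (Site 2)} (hp : PSupp p Λ) (hr : PSupp r Λ) : PSupp (pmul p r) Λ := by
  intro t ht
  simp only [SymReplay.pmul, List.mem_flatMap, List.mem_map] at ht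
  obtain ⟨s, hs, s', hs', rfl⟩ := ht
  exact SuppIn_append.2 ⟨hp s hs, hr s' hs'⟩

/-- Helper `PSupp.padj` (S4 chain). -/
theorem PSupp.padj {p : QPoly} {Λ : Finset (Site 2)} (hp : PSupp p Λ) : PSupp (padj p) Λ := by
  intro t ht
  simp only [SymReplay.padj, List.mem_map] at ht
  obtain ⟨s, hs, rfl⟩ := ht
  exact SuppIn_adjWord (hp s hs)

/-- Helper `PSupp.comm` (S4 chain). -/
theorem PSupp.comm {p r : QPoly} {Λ : Finset (Site 2)} (hp : PSupp p Λ) (hr : PSupp r Λ) : PSupp (comm p r) Λ :=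
  (hp.pmul hr).psub (hr.pmul hp)

/-- Helper `PSupp.flatMap` (S4 chain). -/
theorem PSupp.flatMap {α : Type*} {Λ : Finset (Site 2)} (l : List α) (f : α → QPoly)
    (h : ∀ a ∈ l, PSupp (f a) Λ) : PSupp (l.flatMap f) Λ := by
  intro t ht
  rw [List.mem_flatMap] at ht
  obtain ⟨a, ha, ht⟩ := ht
  exact h a ha t ht

/-- Helper `PSupp.nfPoly` (S4 chain). -/
theorem PSupp.nfPoly {p : QPoly} {Λ : Finset (Site 2)} (hp : PSupp p Λ) : PSupp (nfPoly p) Λ := by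
  intro t ht
  simp only [SymReplay.nfPoly, List.mem_flatMap, SymReplay.pscale, List.mem_map] at ht
  obtain ⟨s, hs, t0, ht0, rfl⟩ := ht
  exact fun ℓ hℓ => hp s hs ℓ (nfWord_letters s.2 t0 ht0 hℓ)

/-- Helper `mem_mergeAdj` (S4 chain). -/
theorem mem_mergeAdj : ∀ (p : QPoly), ∀ t ∈ mergeAdj p, ∃ s ∈ p, s.2 = t.2
  | [], t, ht => by simp [mergeAdj] at ht
  | t0 :: rest, t, ht => by
    rw [mergeAdj] at ht
    split at ht
    · next h =>
      simp only [List.mem_singleton] at ht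
      exact ⟨t0, List.mem_cons_self, by rw [ht]⟩
    · next t' rest' h =>
      have ih : ∀ s ∈ t' :: rest', ∃ s0 ∈ rest, s0.2 = s.2 := fun s hs => mem_mergeAdj rest s (h ▸ hs)
      split_ifs at ht with hw
      · rcases List.mem_cons.1 ht with h' | ht
        · exact ⟨t0, List.mem_cons_self, by rw [h']⟩
        · obtain ⟨s, hs, hs'⟩ := ih t (List.mem_cons_of_mem _ ht)
          exact ⟨s, List.mem_cons_of_mem _ hs, hs'⟩
      · rcases List.mem_cons.1 ht with h' | ht
        · exact ⟨t0, List.mem_cons_self, by rw [h']⟩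
        · obtain ⟨s, hs, hs'⟩ := ih t ht
          exact ⟨s, List.mem_cons_of_mem _ hs, hs'⟩

/-- Helper `mem_collect` (S4 chain). -/
theorem mem_collect (p : QPoly) (t : ℚ × Word) (ht : t ∈ collect p) : ∃ s ∈ p, s.2 = t.2 := by
  obtain ⟨s, hs, hs'⟩ := mem_mergeAdj (sortW p) t ht
  exact ⟨s, (sortW_perm p).mem_iff.1 hs, hs'⟩

/-- Helper `PSupp.collect` (S4 chain). -/
theorem PSupp.collect {p : QPoly} {Λ : Finset (Site 2)} (hp : PSupp p Λ) : PSupp (collect p) Λ := fun t ht => by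
  obtain ⟨s, hs, hs'⟩ := mem_collect p t ht
  rw [← hs']
  exact hp s hs

/-- Helper `PSupp_of_psuppIn` (S4 chain). -/
theorem PSupp_of_psuppIn {p : QPoly} {S : List (Site 2)} (h : psuppIn p S = true) : PSupp p S.toFinset :=
  fun t ht => SuppIn_of_suppIn ((psuppIn_iff p S).1 h t ht)

/-- Helper `PSupp.mono` (S4 chain). -/
theorem PSupp.mono {p : QPoly} {Λ Λ' : Finset (Site 2)} (h : Λ ⊆ Λ') (hp : PSupp p Λ) : PSupp p Λ' :=
  fun t ht => (hp t ht).mono h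

/-- Helper `SuppIn_nil` (S4 chain). -/
theorem SuppIn_nil (Λ : Finset (Site 2)) : SuppIn [] Λ := fun ℓ hℓ => absurd hℓ (by simp)

/-- Helper `SuppIn_cons` (S4 chain). -/
theorem SuppIn_cons {ℓ : Letter} {w : Word} {Λ : Finset (Site 2)} : SuppIn (ℓ :: w) Λ ↔ ℓ.x ∈ Λ ∧ SuppIn w Λ := by
  simp only [SuppIn, List.mem_cons, forall_eq_or_imp]

/-- Helper `PSupp_single` (S4 chain). -/
theorem PSupp_single {q : ℚ} {w : Word} {Λ : Finset (Site 2)} (hw : SuppIn w Λ) : PSupp [(q, w)] Λ := by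
  intro t ht
  simp only [List.mem_singleton] at ht
  subst ht
  exact hw

/-- Helper `PSupp_nil` (S4 chain). -/
theorem PSupp_nil (Λ : Finset (Site 2)) : PSupp [] Λ := fun t ht => absurd ht (by simp)

/-- Words of a matrix-form Gram block lie in the frame (from `gramBlockOK`'s support clause). -/
theorem PSupp_gramBlockPoly (B : GramBlock) {Λ : Finset (Site 2)} (hq : ∀ q ∈ B.basis, PSupp q Λ) :
    PSupp (gramBlockPoly B) Λ := by
  unfold gramBlockPoly
  refine PSupp.pscale _ (PSupp.flatMap _ _ fun a ha => PSupp.flatMap _ _ fun b hb => ?_)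
  have ha' : PSupp a.1 Λ := hq _ (List.of_mem_zip ha).1
  have hb' : PSupp b.1 Λ := hq _ (List.of_mem_zip hb).1
  dsimp only
  split_ifs
  · exact PSupp_nil _
  · exact (ha'.padj.pmul hb').pscale _

/-- Helper `PSupp_hop` (S4 chain). -/
theorem PSupp_hop {q : ℚ} {x y : Site 2} {Λ : Finset (Site 2)} (hx : x ∈ Λ) (hy : y ∈ Λ) : PSupp (hop q x y) Λ := by
  intro t ht
  simp only [hop, List.mem_flatMap, List.mem_cons, List.not_mem_nil, or_false] at ht
  obtain ⟨σ, -, rfl | rfl⟩ := ht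
  · exact SuppIn_cons.2 ⟨hx, SuppIn_cons.2 ⟨hy, SuppIn_nil _⟩⟩
  · exact SuppIn_cons.2 ⟨hy, SuppIn_cons.2 ⟨hx, SuppIn_nil _⟩⟩

/-- Helper `PSupp_onsite` (S4 chain). -/
theorem PSupp_onsite {q : ℚ} {x : Site 2} {Λ : Finset (Site 2)} (hx : x ∈ Λ) : PSupp (onsite q x) Λ :=
  PSupp_single (SuppIn_cons.2 ⟨hx, SuppIn_cons.2 ⟨hx, SuppIn_cons.2 ⟨hx, SuppIn_cons.2 ⟨hx, SuppIn_nil _⟩⟩⟩⟩)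

/-- Helper `PSupp_hamPoly` (S4 chain). -/
theorem PSupp_hamPoly (frame : List (Site 2)) : PSupp (hamPoly frame) frame.toFinset := by
  refine PSupp.append (PSupp.flatMap _ _ fun x hx => PSupp_onsite (List.mem_toFinset.2 hx))
    (PSupp.flatMap _ _ fun x hx => PSupp.flatMap _ _ fun y hy => ?_)
  split_ifs
  · exact PSupp_hop (List.mem_toFinset.2 hx) (List.mem_toFinset.2 hy)
  · intro t ht; simp at ht

/-- Helper `PSupp_energyPoly` (S4 chain). -/
theorem PSupp_energyPoly {Λ : Finset (Site 2)} (h0 : thicken ({0} : Finset (Site 2)) 1 ⊆ Λ) : PSupp energyPoly Λ := by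
  have hz : (0 : Site 2) ∈ Λ := h0 (zero_mem_thicken_zero 1)
  have he1 : e1 ∈ Λ := h0 (unitVec_zero_eq_e1 ▸ unitVec_mem_thicken_one 0)
  have he2 : e2 ∈ Λ := h0 (unitVec_one_eq_e2 ▸ unitVec_mem_thicken_one 1)
  have hne1 : -e1 ∈ Λ := h0 (unitVec_zero_eq_e1 ▸ neg_unitVec_mem_thicken_one 0)
  have hne2 : -e2 ∈ Λ := h0 (unitVec_one_eq_e2 ▸ neg_unitVec_mem_thicken_one 1)
  exact ((((PSupp_onsite hz).append (PSupp_hop hz he1)).append (PSupp_hop hz he2)).append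
    (PSupp_hop hne1 hz)).append (PSupp_hop hne2 hz)

/-- Helper `PSupp_densPoly` (S4 chain). -/
theorem PSupp_densPoly {Λ : Finset (Site 2)} (hz : (0 : Site 2) ∈ Λ) (σ : Fin 2) : PSupp (densPoly σ) Λ :=
  PSupp_single (SuppIn_cons.2 ⟨hz, SuppIn_cons.2 ⟨hz, SuppIn_nil _⟩⟩)

/-- Helper `PSupp_spinPlusPoly` (S4 chain). -/
theorem PSupp_spinPlusPoly (frame : List (Site 2)) : PSupp (spinPlusPoly frame) frame.toFinset := by
  intro t ht
  simp only [spinPlusPoly, List.mem_map] at ht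
  obtain ⟨x, hx, rfl⟩ := ht
  exact SuppIn_cons.2 ⟨List.mem_toFinset.2 hx, SuppIn_cons.2 ⟨List.mem_toFinset.2 hx, SuppIn_nil _⟩⟩

/-- Helper `PSupp_spinMinusPoly` (S4 chain). -/
theorem PSupp_spinMinusPoly (frame : List (Site 2)) : PSupp (spinMinusPoly frame) frame.toFinset := by
  intro t ht
  simp only [spinMinusPoly, List.mem_map] at ht
  obtain ⟨x, hx, rfl⟩ := ht
  exact SuppIn_cons.2 ⟨List.mem_toFinset.2 hx, SuppIn_cons.2 ⟨List.mem_toFinset.2 hx, SuppIn_nil _⟩⟩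

/-- Helper `PSupp_lhsPoly` (S4 chain). -/
theorem PSupp_lhsPoly (K : SymCert) {Λ : Finset (Site 2)} (h0 : thicken ({0} : Finset (Site 2)) 1 ⊆ Λ) :
    PSupp (lhsPoly K) Λ :=
  have hz : (0 : Site 2) ∈ Λ := h0 (zero_mem_thicken_zero 1)
  ((PSupp_energyPoly h0).append (PSupp_single (SuppIn_nil _))).append
    ((((PSupp_densPoly hz 0).append (PSupp_densPoly hz 1)).append (PSupp_single (SuppIn_nil _))).pscale _)

/-- The right-hand side polynomial is supported in the frame (from the `wellFormed` clauses). -/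
theorem PSupp_rhsPoly (K : SymCert)
    (hg : ∀ g ∈ K.gram, psuppIn g.2 K.frame = true)
    (hgM : ∀ B ∈ K.gramM, ∀ q ∈ B.basis, psuppIn q K.frame = true)
    (he : ∀ B ∈ K.eom, psuppIn B K.inner = true)
    (hIF : subSites K.inner K.frame = true)
    (hm : ∀ mv ∈ K.moves, suppIn mv.u K.frame = true ∧ suppIn (moveWordF mv.γ mv.v mv.u) K.frame = true)
    (hc : ∀ t ∈ K.charged, suppIn t.2 K.frame = true) (hp : ∀ X ∈ K.wardP, psuppIn X K.frame = true)
    (hm' : ∀ X ∈ K.wardM, psuppIn X K.frame = true) (ha : ∀ t ∈ K.antiH, psuppIn t.2 K.frame = true)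
    (hs : ∀ t ∈ K.slack, suppIn t.2 K.frame = true) :
    PSupp (rhsPoly K) K.frame.toFinset := by
  have hIF' : K.inner.toFinset ⊆ K.frame.toFinset := fun x hx =>
    List.mem_toFinset.2 ((subSites_iff _ _).1 hIF x (List.mem_toFinset.1 hx))
  refine PSupp.append ?_ (fun t ht => SuppIn_of_suppIn (hs t ht))
  refine PSupp.append ?_ (PSupp.flatMap _ _ fun t ht => ((PSupp_of_psuppIn (ha t ht)).padj.psub
    (PSupp_of_psuppIn (ha t ht))).pscale _)
  refine PSupp.append ?_ (PSupp.flatMap _ _ fun X hX =>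
    (PSupp_spinMinusPoly K.frame).comm (PSupp_of_psuppIn (hm' X hX)))
  refine PSupp.append ?_ (PSupp.flatMap _ _ fun X hX =>
    (PSupp_spinPlusPoly K.frame).comm (PSupp_of_psuppIn (hp X hX)))
  refine PSupp.append ?_ (fun t ht => SuppIn_of_suppIn (hc t ht))
  refine PSupp.append ?_ (PSupp.flatMap _ _ fun mv hmv => ?_)
  · refine PSupp.append ?_ (PSupp.flatMap _ _ fun B hB => (PSupp_hamPoly K.frame).comm
      ((PSupp_of_psuppIn (he B hB)).mono hIF'))
    refine PSupp.append ?_ (PSupp.flatMap _ _ fun B hB => PSupp_gramBlockPoly B fun q hq =>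
      PSupp_of_psuppIn (hgM B hB q hq))
    exact PSupp.flatMap _ _ fun g hg' => ((PSupp_of_psuppIn (hg g hg')).padj.pmul
      (PSupp_of_psuppIn (hg g hg'))).pscale _
  · intro t ht
    simp only [List.mem_cons, List.not_mem_nil, or_false] at ht
    rcases ht with rfl | rfl
    · rw [← moveWordF_eq]; exact SuppIn_of_suppIn (hm mv hmv).2
    · exact SuppIn_of_suppIn (hm mv hmv).1

/-! ##### (i) The residual and its identification expansion; the enlarged frame `Λ'⁺` -/

/-- Helper `subset_foldr_d4ShiftSet` (S4 chain). -/
theorem subset_foldr_d4ShiftSet (F : Finset (Site 2)) :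
    ∀ (l : List IdUse), ∀ e ∈ l, d4ShiftSet e.γ e.v F ⊆ l.foldr (fun e S => d4ShiftSet e.γ e.v F ∪ S) ∅
  | [], e, he => absurd he (by simp)
  | e' :: l, e, he => by
    rw [List.foldr_cons]
    rcases List.mem_cons.1 he with rfl | he
    · exact Finset.subset_union_left
    · exact (subset_foldr_d4ShiftSet F l e he).trans Finset.subset_union_right

/-- Helper `d4ShiftSet_subset_bigFrame` (S4 chain). -/
theorem d4ShiftSet_subset_bigFrame (K : SymCert) {e : IdUse} (he : e ∈ ttList K) :
    d4ShiftSet e.γ e.v K.frame.toFinset ⊆ bigFrame K :=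
  (subset_foldr_d4ShiftSet _ _ e he).trans Finset.subset_union_right

/-- Helper `thicken_subset_bigFrame` (S4 chain). -/
theorem thicken_subset_bigFrame (K : SymCert) : thicken K.frame.toFinset 1 ⊆ bigFrame K :=
  Finset.subset_union_left

/-- Helper `sum_canonTerm` (S4 chain). -/
theorem sum_canonTerm (h1 : NfFaithful) {Λ' : Finset (Site 2)} (corner : Site 2) (frame : List (Site 2))
    (hfr : frame.toFinset ⊆ Λ') :
    ∀ (N : QPoly), polyOp Λ' N - polyOp Λ' (N.flatMap (canonTermA corner frame)) =
        ((N.flatMap (usesOfTerm corner frame)).map (useOp Λ')).sum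
  | [] => by simp
  | t :: N => by
    rw [List.flatMap_cons, List.flatMap_cons, polyOp_append, polyOp_cons, List.map_append, List.sum_append,
      ← sum_canonTerm h1 corner frame hfr N, ← canonTermA_sound h1 corner frame hfr t]
    abel

/-- **The residual equation**: `identityOK` ⇒ `LHS − RHS = Σ (canonical identification uses)` in `𝔄_{Λ'}`
for every `Λ'` containing the frame. -/
theorem residual_expansion (h1 : NfFaithful) (K : SymCert) {Λ' : Finset (Site 2)}
    (hfr : K.frame.toFinset ⊆ Λ') (hsupp : PSupp (psub (lhsPoly K) (rhsPoly K)) Λ') (hid : identityOK K = true) :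
    polyOp Λ' (lhsPoly K) - polyOp Λ' (rhsPoly K) = ((canonUses K).map (useOp Λ')).sum := by
  have hres : polyOp Λ' (residual K) = polyOp Λ' (lhsPoly K) - polyOp Λ' (rhsPoly K) := by
    rw [residual, polyOp_eq_evalP, collect_eval, ← polyOp_eq_evalP, polyOp_nfPoly h1 _ _ hsupp, polyOp_psub]
  change isZero (if K.useCanon then (residual K).flatMap (canonTermA (flatSite (minCorner K.frame)) K.frame)
    else residual K) = true at hid
  rw [← hres, canonUses]
  cases hc : K.useCanon
  · simp only [hc, Bool.false_eq_true, if_false] at hid ⊢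
    rw [List.map_nil, List.sum_nil]
    exact polyOp_eq_zero_of_isZero Λ' _ hid
  · simp only [hc, if_true] at hid ⊢
    rw [← sum_canonTerm h1 _ _ hfr (residual K), polyOp_eq_zero_of_isZero Λ' _ hid, sub_zero]

/-- Helper `ttList_supp` (S4 chain). -/
theorem ttList_supp (K : SymCert)
    (hmov : ∀ mv ∈ K.moves, suppIn mv.u K.frame = true ∧ suppIn (moveWordF mv.γ mv.v mv.u) K.frame = true)
    (hres : PSupp (residual K) K.frame.toFinset) : ∀ e ∈ ttList K, SuppIn e.u K.frame.toFinset := by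
  intro e he
  rw [ttList, List.mem_append] at he
  rcases he with he | he
  · rw [List.mem_map] at he
    obtain ⟨mv, hmv, rfl⟩ := he
    exact SuppIn_of_suppIn (hmov mv hmv).1
  · rw [canonUses] at he
    split_ifs at he with hc
    · rw [List.mem_flatMap] at he
      obtain ⟨t, ht, he⟩ := he
      rw [(usesOfTerm_spec e he).1]
      exact hres t ht
    · simp at he

end Summit.Ventures.CertifiedManyBodySolver.Theorems.SymReplay

end
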